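import Mathlib
import Summits.ValiantsHypothesis.ValiantsHypothesis.Theorems.ValuativeGCTValuativeFlipTridiagonalSubmersion

/-!
# Row 3 of the few-row table: the padded permanent never beats the determinant on three-row shapes

Crux `ValuativeGCT.ValuativeFlip` (stmt-ValiantsHypothesis-12624), wall-breaker axis 14
("plethysm tables, small cases certified"), gen 1 — add-on over `…TridiagonalSubmersion` (ternary
forms are border-determinantal).

* `paddedPer_orbitMultiplicity_le_det_of_card_parts_le_three` (registered stub) — for every
  `n ≤ m` and `λ ⊢ mδ` with `ℓ(λ) ≤ 3`: `mult_{λ*} ℂ[Δ_m(X₀₀^{m-n} per_n)] ≤ K_m(λ*)`, at ANY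
  padding (no largeness of `m`, in contrast with the bounded-length no-go);
* `paddedPer_le_plethysm_eq_det_of_card_parts_le_three` — the three-row sandwich
  `mult_pp(λ*) ≤ a_λ(δ[m]) = K_m(λ*)` (`= plethysmCoeffOfPartition ℂ k m λ`, `ℓ(λ) ≤ 3 ≤ k ≤ m²`):
  rows `≤ 3` of the few-row plethysm table ARE the determinant's multiplicities, for every `m`.

References: BLMW, SIAM J. Comput. 40 (2011) §5.3; this crux (k14 gen 0 `…TwoRowNoFlip`,
`…DetEqFreeTwoLetters`; gen 1 `…TridiagonalSubmersion`).
-/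

set_option linter.dupNamespace false

namespace Summit.ValiantsHypothesis.ValiantsHypothesis.Theorems.ValuativeFlip

open MvPolynomial
open scoped BigOperators Matrix
open Literature.NumberTheory.DiophantineGeometry Literature.Computability.AlgebraicComplexity

noncomputable section

/-- **No multiplicity obstruction on shapes with at most three rows, at any padding.** For `n ≤ m`
and `λ ⊢ mδ` with `ℓ(λ) ≤ 3` (and `ℓ(λ) ≤ m²`):
`mult_{λ*} ℂ[Δ_m(X₀₀^{m-n} per_n)] ≤ K_m(λ*) = mult_{λ*} ℂ[Δ(det_m)]` — the padded permanent can
never beat the determinant on a three-row shape (the dual weight `λ*` lives on the last three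
letters, where `Det_m` majorises every orbit closure,
`orbitMultiplicity_le_det_of_support_card_le_three`). Extends
`orbitMultiplicity_paddedPer_le_det_of_card_parts_le_two` by one row; with
`det_orbitMultiplicity_eq_plethysmCoeffOfPartition_of_card_parts_le_three` both sides are at most,
and the det side is exactly, the plethysm coefficient `a_λ(δ[m])`. [this crux] -/
theorem paddedPer_orbitMultiplicity_le_det_of_card_parts_le_three : ∀ {n m : ℕ} [NeZero m], n ≤ m → ∀ {δ : ℕ} (lam : Nat.Partition (m * δ)), lam.parts.card ≤ 3 → lam.parts.card ≤ m * m → orbitMultiplicity ℂ (paddedPerFormLex ℂ n m) m (Weight.dualOfPartition (m * m) lam).toMatIdx ≤ orbitMultiplicity ℂ (detFormLex ℂ m) m (Weight.dualOfPartition (m * m) lam).toMatIdx := by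
  intro n m _ hnm δ lam h3 hcard
  classical
  set ρ := lam.parts.card with hρ
  let S : Finset (MatIdx m) := Finset.univ.image fun t : Fin ρ =>
    matIdxEquiv m ⟨m * m - 1 - t, by have := t.2; omega⟩
  have hScard : S.card ≤ 3 := Finset.card_image_le.trans (by simpa using h3)
  have hχ : ∀ i, i ∉ S → (Weight.dualOfPartition (m * m) lam).toMatIdx i = 0 := by
    intro i hi
    obtain ⟨i', rfl⟩ : ∃ i' : Fin (m * m), matIdxEquiv m i' = i :=
      ⟨(matIdxEquiv m).symm i, (matIdxEquiv m).apply_symm_apply i⟩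
    by_cases hlt : (i' : ℕ) + ρ < m * m
    · exact NoValuativeFlip.dualOfPartition_toMatIdx_eq_zero_of_lt lam i' hlt
    · exfalso
      apply hi
      refine Finset.mem_image.mpr ⟨⟨m * m - 1 - i', by omega⟩, Finset.mem_univ _, ?_⟩
      congr 1
      exact Fin.ext (by simp; omega)
  exact orbitMultiplicity_le_det_of_support_card_le_three (paddedPerFormLex_isHomogeneous (k := ℂ) hnm)
    S hScard _ hχ

/-- **The three-row sandwich.** For `n ≤ m`, `λ ⊢ mδ` with `ℓ(λ) ≤ 3 ≤ k ≤ m²`: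
`mult_{λ*} ℂ[Δ_m(X₀₀^{m-n} per_n)] ≤ a_λ(δ[m]) = K_m(λ*)`, the common value being the `GL_k`
plethysm coefficient `plethysmCoeffOfPartition ℂ k m λ` — rows `≤ 3` of the few-row plethysm table
ARE the determinant's multiplicities, certified for every `m`. [this crux] -/
theorem paddedPer_le_plethysm_eq_det_of_card_parts_le_three {n m : ℕ} [NeZero m]
    (hnm : n ≤ m) {k δ : ℕ} (hk : k ≤ m * m) (lam : Nat.Partition (m * δ)) (h3 : lam.parts.card ≤ 3)
    (hlam : lam.parts.card ≤ k) :
    orbitMultiplicity ℂ (paddedPerFormLex ℂ n m) m (Weight.dualOfPartition (m * m) lam).toMatIdx ≤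
        plethysmCoeffOfPartition ℂ k m lam ∧
      orbitMultiplicity ℂ (detFormLex ℂ m) m (Weight.dualOfPartition (m * m) lam).toMatIdx =
        plethysmCoeffOfPartition ℂ k m lam := by
  have hdet := det_orbitMultiplicity_eq_plethysmCoeffOfPartition_of_card_parts_le_three hk lam h3 hlam
  exact ⟨hdet ▸ paddedPer_orbitMultiplicity_le_det_of_card_parts_le_three hnm lam h3 (hlam.trans hk), hdet⟩

end

end Summit.ValiantsHypothesis.ValiantsHypothesis.Theorems.ValuativeFlip
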